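/-
Copyright: cell `pub-balaban-gaps` (G2), seat ne6 (row NE7b), `prover-pub-balaban-gaps-ne6-g18-0`. Project licence.
-/
import Summits.QuantumFields.BalabanUV.T4Continuum.Spine.NE7b.CompactFibreMeanActionSUNLimit
import Summits.QuantumFields.BalabanUV.T4Continuum.Spine.NE7c.LiveFactorWindowTightSUN

/-!
# THE ONE-PLAQUETTE MASS OF `SU(N)` HAS A CONSTANT AT PRINT's RATE, EVERY `N`: `β^{(N²−1)∕2}·∫ e^{−β·Re tr(1−V)} dHaar_{SU(N)}(V) → c_N > 0`,
# `c_N = (√2)^{N²−1}·C₀(N)·Γ((N²−1)∕2 + 1)` (`C₀(N)` = the exact Hilbert–Schmidt small-ball constant of `SU(N)`), the free-energy constant exists, and the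
# halved-action ∕ live ratio `Z_N(νβ)∕Z_N(β) → ν^{−(N²−1)∕2}` is EXACT at print's rate, and EQUIPARTITION `β·⟨Re tr(1−V)⟩_β → (N²−1)∕2` holds for EVERY `N`
# (row NE7b, node U5c; MODEL, [folklore]; junction J4 = V48 ∕ V49 + ne8's file 36)

Cell `pub-balaban-gaps` (G2 spine census) for the `pub-balaban` T⁴ crux NE7b (`T4WeightBudget.RelWeightBound`; NOT PRINTED, NOT PROVED).  Crux-route work under
`Spine/NE7b/`; junction of this lineage's V48 `CompactFibrePlaquetteMassSUNLimit` (the Abelian theorem: window constant `C` ⟹ Laplace constant `C·Γ(d∕2 + 1)`) and V49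
`CompactFibreMeanActionSUNLimit` (tangent-line Jensen; window constant ⟹ coupling ratio `ν^{−d∕2}` and equipartition `β⟨s⟩_β → d∕2`) with
seat ne8's `Spine/NE7c/LiveFactorWindowTightSUN` (`exists_tendsto_haar_sball_div_pow`: the tree's EXACT small-ball asymptotic of `SU(N)`,
`Summits/Ventures/LatticeQCDFlow/Scaling/SpecialUnitarySmallBall` — exponential chart —, in the lineage's vocabulary, and `tendsto_haar_traceWindow_div_sqrt_pow`:
the same constant for the trace window at radius `√(2t)`) — both consumed BY NAME; Mathlib otherwise; no `def`, zero `sorry`, nothing of Bałaban's asserted.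

THE LOCATED QUESTION (junction J4, closing V48's hypothesis for every `N`).  V39: `c·β^{−(N²−1)∕2} ≤ Z_N(β) ≤ C′·β^{−(N²−1)∕2}` with SOFT `c, C′` and the RATE
`−log Z_N∕log β → (N²−1)∕2`; V45 (N = 2): THE constant `(2√π)⁻¹`; V48: for every `N`, a window constant gives a Laplace constant.  QUESTION: does the window constant
EXIST for every `N` — so that `β^{(N²−1)∕2}·Z_N(β)` CONVERGES, V39's bracket `[c, C′]` collapsing to one number `c_N` — and what follows for the halved-action letter?

ANSWER ([folklore]):
* §1 **`exists_tendsto_traceWindow_div_sqrt_pow`** — EVERY `N`: `∃ C > 0`, `Haar_{SU(N)}{Re tr(1−V) ≤ t}∕(√t)^{N²−1} → C` as `t → 0⁺`, `C = (√2)^{N²−1}·C₀(N)`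
  (ne8's two theorems + `√(2t) = √2·√t`); `tendsto_traceWindow_div_sqrt_pow_of_sball` (the same with `C₀` as datum).
* §2 **`tendsto_scaled_plaquetteMass_SUN_of_sball`** (`C₀` as datum: limit `(√2)^{N²−1}·C₀·Γ((N²−1)∕2 + 1)`) and **`exists_tendsto_scaled_plaquetteMass_SUN`** —
  EVERY `N`: `∃ c_N > 0, (√β)^{N²−1}·∫ e^{−β·Re tr(1−V)} dHaar_{SU(N)}(V) → c_N` as `β → ∞`: V39's two-sided bracket IS a limit; **`exists_tendsto_freeEnergy_constant_SUN`**: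
  `∃ c₁, −log Z_N(β) − ((N²−1)∕2)·log β → c₁` (V39's `|…| ≤ c₁` becomes convergence, every `N`).
* §3 **`tendsto_plaquetteMass_ratio_SUN`** — EVERY `N`, every `ν > 0`: `Z_N(νβ)∕Z_N(β) → ((√ν)⁻¹)^{N²−1}` as `β → ∞` (V49 §2 fed with §1); in the halved-action letter's form
  (**`tendsto_halvedAction_ratio_SUN`**, `δ < 1`): `∫e^{δβs}e^{−βs} ∕ ∫e^{−βs} = Z_N((1−δ)β)∕Z_N(β) → ((√(1−δ))⁻¹)^{N²−1}` — V38's β-uniform bound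
  `≤ D·((√(1−δ))⁻¹)^{N²−1}` has the EXACT rate for every `N` and no constant `D < 1` can hold (J2∕J3: `D = 1`, strict, for `N = 2` at every `β`); the refuter's
  quadrature «D_true = 1 for N = 2, 3» is, in the limit `β → ∞`, a theorem for every `N`.
* §3b **`tendsto_mul_meanAction_SUN`** — EQUIPARTITION FOR EVERY `N`, UNCONDITIONALLY: `β·∫ Re tr(1−V)·e^{−β·Re tr(1−V)} dHaar_{SU(N)} ∕ ∫ e^{−β·Re tr(1−V)} dHaar_{SU(N)}
  → (N²−1)∕2` as `β → ∞` — the mean one-plaquette action is `dim SU(N)∕(2β)` to leading order (V49 §3 fed with §1; V46: the mean at `β = 0` is `N`; V44 §8 ∕ V49 §4: `N = 2`,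
  `< 3∕2` at every `β`, `→ 3∕2`).
* §4 `N = 2` CROSS-CHECK: **`scaled_plaquetteMass_SU2_const_eq`** — any limit `c` of `(√β)³·Z_{SU(2)}(β)` equals `(2√π)⁻¹` (uniqueness of limits against V48 §3:
  ne8's window constant `2∕(3π)` × `Γ(5∕2)`; = V45's constant); so `c_2 = (2√π)⁻¹ = 0.28209…`, and with ne8's `asymptotic_const_SU2_eq` (`C₀(2) = 1∕(3√2·π)`) the
  formula `c_N = (√2)^{N²−1}·C₀(N)·Γ((N²+1)∕2)` reads `2√2·(3√2·π)⁻¹·(3√π∕4) = (2√π)⁻¹` ✓.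

HONEST REMARKS.  (i) MODEL ∕ [folklore]: ONE plaquette variable under Haar; nothing of the interacting measure.  (ii) `C₀(N)` (hence `c_N`) is NOT valued for `N ≥ 3`
(the tree's constant is existential: `vol B^{N²−1}∕vol_HS SU(N)` is not computed there); no rate of convergence; no monotonicity in `β` for `N ≥ 3` (V44∕J3 are `N = 2`).
(iii) (A3) ∕ (A1c) NOT asserted; NC-NE7b-α UNRULED.  BY-NAME EFFECT ON THE WALL: NONE.  NE7b NOT PRINTED ∕ NOT PROVED; spine PROVED 0∕9; rung (B)+1 on ONE finite T⁴ —
NOT infinite volume, NOT the mass gap, NOT Clay.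
HONEST DEPENDENCY: continuum YM on T⁴ ⇐ BetaPertH ∧ nine spine estimates (0/9 proved); BetaPertH ⇐ (D1) ∧ (D4) ∧ CAP+tail;
G-an2-4 gates asym, D1 and NE2/3/4.  This file changes none of it.
-/

set_option autoImplicit false

noncomputable section

open MeasureTheory Real Set Filter Topology
open scoped Matrix.Norms.Frobenius
open Literature.MathematicalPhysics.QuantumFieldTheory (haarProbability)
open Summit.QuantumFields.BalabanUV.T4Continuum.NE7b.CompactFibrePlaquetteMassSUNLimit
  (tendsto_scaled_plaquetteMass_SUN_of_window tendsto_freeEnergy_constant_SUN_of_window plaquetteMass_SUN_pos tendsto_scaled_plaquetteMass_SU2_of_window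
    window_const_mul_Gamma_five_halves_eq)
open Summit.QuantumFields.BalabanUV.T4Continuum.NE7b.CompactFibreMeanActionSUNLimit (tendsto_plaquetteMass_ratio_SUN_of_window tendsto_mul_meanAction_SUN_of_window)
open Summit.QuantumFields.BalabanUV.T4Continuum.Spine.NE7c.LiveFactorWindowTightSUN (exists_tendsto_haar_sball_div_pow tendsto_haar_traceWindow_div_sqrt_pow)

namespace Summit.QuantumFields.BalabanUV.T4Continuum.NE7b.CompactFibrePlaquetteMassSUNConstant

variable {N : ℕ}

/-! ## §1 The trace-window constant exists for every `N` -/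

/-- **THE TRACE-WINDOW CONSTANT FROM THE SMALL-BALL CONSTANT**: if `Haar_{SU(N)}{‖V − 1‖_HS ≤ η}∕η^{N²−1} → C₀` as `η → 0⁺` then
`Haar_{SU(N)}{Re tr(1−V) ≤ t}∕(√t)^{N²−1} → (√2)^{N²−1}·C₀` as `t → 0⁺` (ne8's `tendsto_haar_traceWindow_div_sqrt_pow` at radius `√(2t) = √2·√t`). [folklore] -/
theorem tendsto_traceWindow_div_sqrt_pow_of_sball {C₀ : ℝ}
    (h : Tendsto (fun η : ℝ => (haarProbability (Matrix.specialUnitaryGroup (Fin N) ℂ)).real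
      {V : Matrix.specialUnitaryGroup (Fin N) ℂ | ‖(V : Matrix (Fin N) (Fin N) ℂ) - 1‖ ≤ η} / η ^ (N ^ 2 - 1)) (𝓝[>] 0) (𝓝 C₀)) :
    Tendsto (fun t : ℝ => (haarProbability (Matrix.specialUnitaryGroup (Fin N) ℂ)).real
      {V : Matrix.specialUnitaryGroup (Fin N) ℂ | (Matrix.trace (1 - (V : Matrix (Fin N) (Fin N) ℂ))).re ≤ t} / Real.sqrt t ^ (N ^ 2 - 1))
      (𝓝[>] 0) (𝓝 (Real.sqrt 2 ^ (N ^ 2 - 1) * C₀)) := by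
  have h2 := (tendsto_haar_traceWindow_div_sqrt_pow h).const_mul (Real.sqrt 2 ^ (N ^ 2 - 1))
  refine h2.congr' ?_
  filter_upwards [self_mem_nhdsWithin] with t ht
  have ht0 : 0 < t := Set.mem_Ioi.1 ht
  have hs2 : 0 < Real.sqrt 2 ^ (N ^ 2 - 1) := pow_pos (Real.sqrt_pos.2 two_pos) _
  have hst : 0 < Real.sqrt t ^ (N ^ 2 - 1) := pow_pos (Real.sqrt_pos.2 ht0) _
  rw [Real.sqrt_mul (by norm_num : (0 : ℝ) ≤ 2), mul_pow]
  field_simp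

/-- **THE TRACE-WINDOW CONSTANT EXISTS, EVERY `N`**: `∃ C > 0, Haar_{SU(N)}{Re tr(1−V) ≤ t}∕(√t)^{N²−1} → C` as `t → 0⁺`
(`C = (√2)^{N²−1}·C₀(N)`, `C₀(N)` the tree's exact Hilbert–Schmidt small-ball constant of `SU(N)`; `N = 2`: `C = 2∕(3π)`, ne8's file 31). [folklore] -/
theorem exists_tendsto_traceWindow_div_sqrt_pow :
    ∃ C : ℝ, 0 < C ∧ Tendsto (fun t : ℝ => (haarProbability (Matrix.specialUnitaryGroup (Fin N) ℂ)).real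
      {V : Matrix.specialUnitaryGroup (Fin N) ℂ | (Matrix.trace (1 - (V : Matrix (Fin N) (Fin N) ℂ))).re ≤ t} / Real.sqrt t ^ (N ^ 2 - 1))
      (𝓝[>] 0) (𝓝 C) := by
  obtain ⟨C₀, hC₀, h⟩ := exists_tendsto_haar_sball_div_pow (N := N)
  exact ⟨_, mul_pos (pow_pos (Real.sqrt_pos.2 two_pos) _) hC₀, tendsto_traceWindow_div_sqrt_pow_of_sball h⟩

/-! ## §2 The one-plaquette mass constant and the free-energy constant exist for every `N` -/

/-- **THE ONE-PLAQUETTE MASS CONSTANT FROM THE SMALL-BALL CONSTANT, EVERY `N`**: if `Haar_{SU(N)}{‖V − 1‖_HS ≤ η}∕η^{N²−1} → C₀` then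
`(√β)^{N²−1}·∫ e^{−β·Re tr(1−V)} dHaar_{SU(N)}(V) → (√2)^{N²−1}·C₀·Γ((N²−1)∕2 + 1)` as `β → ∞`. [folklore] -/
theorem tendsto_scaled_plaquetteMass_SUN_of_sball {C₀ : ℝ}
    (h : Tendsto (fun η : ℝ => (haarProbability (Matrix.specialUnitaryGroup (Fin N) ℂ)).real
      {V : Matrix.specialUnitaryGroup (Fin N) ℂ | ‖(V : Matrix (Fin N) (Fin N) ℂ) - 1‖ ≤ η} / η ^ (N ^ 2 - 1)) (𝓝[>] 0) (𝓝 C₀)) :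
    Tendsto (fun β : ℝ => Real.sqrt β ^ (N ^ 2 - 1) *
        ∫ V, Real.exp (-(β * (Matrix.trace (1 - (V : Matrix (Fin N) (Fin N) ℂ))).re)) ∂(haarProbability (Matrix.specialUnitaryGroup (Fin N) ℂ)))
      atTop (𝓝 (Real.sqrt 2 ^ (N ^ 2 - 1) * C₀ * Real.Gamma (((N ^ 2 - 1 : ℕ) : ℝ) / 2 + 1))) :=
  tendsto_scaled_plaquetteMass_SUN_of_window (tendsto_traceWindow_div_sqrt_pow_of_sball h)

/-- **THE ONE-PLAQUETTE MASS OF `SU(N)` HAS A CONSTANT AT PRINT's RATE, EVERY `N`**: `∃ c_N > 0`,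
`(√β)^{N²−1}·∫ e^{−β·Re tr(1−V)} dHaar_{SU(N)}(V) → c_N` as `β → ∞` — V39's bracket `c·β^{−(N²−1)∕2} ≤ Z_N(β) ≤ C′·β^{−(N²−1)∕2}` IS a limit
(`c_N = (√2)^{N²−1}·C₀(N)·Γ((N²−1)∕2 + 1)`; `c_2 = (2√π)⁻¹`, §4). [folklore] -/
theorem exists_tendsto_scaled_plaquetteMass_SUN :
    ∃ c : ℝ, 0 < c ∧ Tendsto (fun β : ℝ => Real.sqrt β ^ (N ^ 2 - 1) *
        ∫ V, Real.exp (-(β * (Matrix.trace (1 - (V : Matrix (Fin N) (Fin N) ℂ))).re)) ∂(haarProbability (Matrix.specialUnitaryGroup (Fin N) ℂ)))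
      atTop (𝓝 c) := by
  obtain ⟨C, hC, h⟩ := exists_tendsto_traceWindow_div_sqrt_pow (N := N)
  exact ⟨_, mul_pos hC (Real.Gamma_pos_of_pos (by positivity)), tendsto_scaled_plaquetteMass_SUN_of_window h⟩

/-- **THE FREE-ENERGY CONSTANT EXISTS, EVERY `N`**: `∃ c₁, −log ∫ e^{−β·Re tr(1−V)} dHaar_{SU(N)}(V) − ((N²−1)∕2)·log β → c₁` as `β → ∞`
(V39's `|−log Z_N(β) − ((N²−1)∕2)·log β| ≤ c₁` for `β ≥ 1` becomes CONVERGENCE; `c₁ = −log c_N`; `N = 2`: `log(2√π) = 1.2655…`, V45). [folklore] -/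
theorem exists_tendsto_freeEnergy_constant_SUN :
    ∃ c₁ : ℝ, Tendsto (fun β : ℝ =>
        -Real.log (∫ V, Real.exp (-(β * (Matrix.trace (1 - (V : Matrix (Fin N) (Fin N) ℂ))).re)) ∂(haarProbability (Matrix.specialUnitaryGroup (Fin N) ℂ)))
          - ((N ^ 2 - 1 : ℕ) : ℝ) / 2 * Real.log β)
      atTop (𝓝 c₁) := by
  obtain ⟨C, hC, h⟩ := exists_tendsto_traceWindow_div_sqrt_pow (N := N)
  exact ⟨_, tendsto_freeEnergy_constant_SUN_of_window hC h⟩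

/-! ## §3 The halved-action ∕ live ratio is EXACT at print's rate for every `N` -/

/-- **THE COUPLING RATIO IS EXACT AT RATE `½·d(𝔤)`, EVERY `N`**: for every `ν > 0`,
`∫ e^{−νβ·Re tr(1−V)} dHaar_{SU(N)} ∕ ∫ e^{−β·Re tr(1−V)} dHaar_{SU(N)} → ((√ν)⁻¹)^{N²−1}` as `β → ∞`. [folklore] -/
theorem tendsto_plaquetteMass_ratio_SUN {ν : ℝ} (hν : 0 < ν) :
    Tendsto (fun β : ℝ =>
        (∫ V, Real.exp (-(ν * β * (Matrix.trace (1 - (V : Matrix (Fin N) (Fin N) ℂ))).re)) ∂(haarProbability (Matrix.specialUnitaryGroup (Fin N) ℂ))) /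
          ∫ V, Real.exp (-(β * (Matrix.trace (1 - (V : Matrix (Fin N) (Fin N) ℂ))).re)) ∂(haarProbability (Matrix.specialUnitaryGroup (Fin N) ℂ)))
      atTop (𝓝 ((Real.sqrt ν)⁻¹ ^ (N ^ 2 - 1))) := by
  obtain ⟨C, hC, h⟩ := exists_tendsto_traceWindow_div_sqrt_pow (N := N)
  exact tendsto_plaquetteMass_ratio_SUN_of_window hC h hν

/-- **THE HALVED-ACTION LETTER's RATE IS EXACT, EVERY `N`** (V38's letter in the limit `β → ∞`): for `δ < 1` (V38: `0 ≤ δ < 1`),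
`∫ e^{δβ·Re tr(1−V)}·e^{−β·Re tr(1−V)} dHaar_{SU(N)} ∕ ∫ e^{−β·Re tr(1−V)} dHaar_{SU(N)} → ((√(1−δ))⁻¹)^{N²−1}` — V38's β-uniform bound `≤ D·((√(1−δ))⁻¹)^{N²−1}`
has the exact rate and admits no constant `D < 1`, for every `N` (J2∕J3: `D = 1`, strict, `N = 2`, every `β`). [folklore] -/
theorem tendsto_halvedAction_ratio_SUN {δ : ℝ} (hδ1 : δ < 1) :
    Tendsto (fun β : ℝ =>
        (∫ V, Real.exp (δ * β * (Matrix.trace (1 - (V : Matrix (Fin N) (Fin N) ℂ))).re) * Real.exp (-(β * (Matrix.trace (1 - (V : Matrix (Fin N) (Fin N) ℂ))).re))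
            ∂(haarProbability (Matrix.specialUnitaryGroup (Fin N) ℂ))) /
          ∫ V, Real.exp (-(β * (Matrix.trace (1 - (V : Matrix (Fin N) (Fin N) ℂ))).re)) ∂(haarProbability (Matrix.specialUnitaryGroup (Fin N) ℂ)))
      atTop (𝓝 ((Real.sqrt (1 - δ))⁻¹ ^ (N ^ 2 - 1))) := by
  have h := tendsto_plaquetteMass_ratio_SUN (N := N) (ν := 1 - δ) (by linarith)
  refine h.congr' (Eventually.of_forall fun β => ?_)
  have hrew : ∀ V : Matrix.specialUnitaryGroup (Fin N) ℂ,
      Real.exp (-((1 - δ) * β * (Matrix.trace (1 - (V : Matrix (Fin N) (Fin N) ℂ))).re))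
        = Real.exp (δ * β * (Matrix.trace (1 - (V : Matrix (Fin N) (Fin N) ℂ))).re) * Real.exp (-(β * (Matrix.trace (1 - (V : Matrix (Fin N) (Fin N) ℂ))).re)) :=
    fun V => by rw [← Real.exp_add]; ring_nf
  simp_rw [hrew]

/-! ## §3b Equipartition for every `N`, unconditionally -/

/-- **EQUIPARTITION AT WEAK COUPLING, EVERY `N`, UNCONDITIONALLY**: `β·∫ Re tr(1−V)·e^{−β·Re tr(1−V)} dHaar_{SU(N)}(V) ∕ ∫ e^{−β·Re tr(1−V)} dHaar_{SU(N)}(V) → (N²−1)∕2`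
as `β → ∞` — the mean one-plaquette action under the compact-fibre reference weight is `dim SU(N)∕(2β)` to leading order, for every `N` (V49 §3's conditional theorem fed
with §1's window constant; no chart, no Weyl, no differentiation under the Haar integral). [folklore] -/
theorem tendsto_mul_meanAction_SUN :
    Tendsto (fun β : ℝ => β *
        ((∫ V, (Matrix.trace (1 - (V : Matrix (Fin N) (Fin N) ℂ))).re * Real.exp (-(β * (Matrix.trace (1 - (V : Matrix (Fin N) (Fin N) ℂ))).re))
            ∂(haarProbability (Matrix.specialUnitaryGroup (Fin N) ℂ))) /
          ∫ V, Real.exp (-(β * (Matrix.trace (1 - (V : Matrix (Fin N) (Fin N) ℂ))).re)) ∂(haarProbability (Matrix.specialUnitaryGroup (Fin N) ℂ))))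
      atTop (𝓝 (((N ^ 2 - 1 : ℕ) : ℝ) / 2)) := by
  obtain ⟨C, hC, h⟩ := exists_tendsto_traceWindow_div_sqrt_pow (N := N)
  exact tendsto_mul_meanAction_SUN_of_window hC h

/-! ## §4 `N = 2` cross-check: `c_2 = (2√π)⁻¹` -/

/-- **`c_2 = (2√π)⁻¹`**: any limit `c` of `(√β)³·Z_{SU(2)}(β)` (in particular the `c_N` of §2 at `N = 2`, `2² − 1 = 3`) equals `(2√π)⁻¹ = 0.28209…`
(uniqueness of limits against V48 §3 — ne8's window constant `2∕(3π)` times `Γ(5∕2) = 3√π∕4` —; = V45's constant from Weyl's density). [folklore] -/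
theorem scaled_plaquetteMass_SU2_const_eq {c : ℝ}
    (h : Tendsto (fun β : ℝ => Real.sqrt β ^ 3 *
        ∫ U, Real.exp (-(β * (Matrix.trace (1 - (U : Matrix (Fin 2) (Fin 2) ℂ))).re)) ∂(haarProbability (Matrix.specialUnitaryGroup (Fin 2) ℂ))) atTop (𝓝 c)) :
    c = (2 * Real.sqrt Real.pi)⁻¹ := by
  rw [← window_const_mul_Gamma_five_halves_eq]
  exact tendsto_nhds_unique h tendsto_scaled_plaquetteMass_SU2_of_window

/-- The §2 constant of `SU(2)` in the `N ^ 2 − 1` indexing: `(√β)^{2²−1}·Z_{SU(2)}(β) → (2√π)⁻¹`. [folklore] -/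
theorem tendsto_scaled_plaquetteMass_SU2_pow_form :
    Tendsto (fun β : ℝ => Real.sqrt β ^ (2 ^ 2 - 1) *
        ∫ U, Real.exp (-(β * (Matrix.trace (1 - (U : Matrix (Fin 2) (Fin 2) ℂ))).re)) ∂(haarProbability (Matrix.specialUnitaryGroup (Fin 2) ℂ)))
      atTop (𝓝 ((2 * Real.sqrt Real.pi)⁻¹)) := by
  rw [show (2 : ℕ) ^ 2 - 1 = 3 by norm_num, ← window_const_mul_Gamma_five_halves_eq]
  exact tendsto_scaled_plaquetteMass_SU2_of_window

end Summit.QuantumFields.BalabanUV.T4Continuum.NE7b.CompactFibrePlaquetteMassSUNConstant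

end
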